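import Mathlib
import Summits.NavierStokesRegularity.NavierStokesRegularity.Theorems.ThreadingFluxHorizonTowerZonalSlot
import HarnessLib

/-!
# Crux `PoloidalLiouville` (stmt-NavierStokesRegularity-1222, wall W1), crux idea «horizon-threading-tower» (ns-idea-15):
# ALL-DEGREE horizon zonality, kernel part F5c — weight bounds, top component of `D̃`, the mirror, and the TOP-WEIGHT THEOREM

Support file (Theorems-side tooling; seat ns-wall-eng-5 g4, cell ns-wall-extremal, W1 adjunct; `--supports stmt-NavierStokesRegularity-1222
--as helper`).  Memo of record: pub/ns-wall-extremal/ARM-B/zonal-eng5/PROOF-HZSD-ALL-L.md (DATUM B-w5.8; critic-replicated, ns-wall-crit-1 g2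
2026-08-28T22:52:10Z).  In the complex coordinates `(W, V, Z) = (w, w̄, z)` of `ThreadingFluxHorizonTowerZonalAlgebra.lean`:

* weight BOUNDS `WB β P` («all monomials of `P` have azimuthal weight `≤ β`») and their behaviour under `+, −, ·, ∂, Λ, dotC, tripleC`;
* weight components commute with `Δ̃` (`wcomp_lapC`) and the **top component of the cubic form** `D̃`: if all weights of `Q` are `≤ β`
  then the weight-`3β` component of `D̃(Q)` is `D̃(Q_β)` (`wcomp_detC_top`; memo §1(b): trilinear, weight-additive);
* the `W ↔ V` mirror (`rename (swap 0 1)`): `Δ̃` even, `dotC` even, `Λ` odd, `tripleC`/`D̃` odd, weights negated;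
* ★ `weight_nonpos_of_detC` / `isWeightedHomogeneous_zero_of_detC`: **a degree-`l` polynomial with `Δ̃Q = 0`, `D̃(Q) = 0` and neither a
  `W^l` nor a `V^l` term has only weight-`0` monomials** (memo Corollary D applied to the top weight and, through the mirror, to the
  bottom weight; the slot theorem `slot_eq_zero` kills every intermediate top slot), hence `ΛQ = 0` (`lam_eq_zero_of_detC`): the polynomial
  is invariant under rotations about the axis.

Pure polynomial algebra; no analysis, no NS statement.  HONEST LABEL: a lemma toward the crux-idea obstruction `HorizonZonalitySingleDegree`
(all `l`); that statement (until the assembly lands), `PoloidalLiouville` (1222), `UnthreadedRigidity` (27585) and NS regularity remain OPEN;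
W1/W2 movement 0.  [folklore]
-/

-- the summit and its single problem share the name (D-0017 nested layout)
set_option linter.dupNamespace false

noncomputable section

open MvPolynomial Finsupp

namespace Summit.NavierStokesRegularity.NavierStokesRegularity.Theorems.PoloidalLiouville.HorizonTower.Zonal

/-! ### Weight bounds, components, the `W ↔ V` mirror, and the TOP-WEIGHT theorem (memo Corollary D, §4) -/

section Descent

variable {P Q A B : CPoly} {β γ : ℤ} {l : ℕ}

/-- All monomials of `P` have azimuthal weight `≤ β` (a weight BOUND; predicate used only inside this proof). [folklore] -/
def WB (β : ℤ) (P : CPoly) : Prop := ∀ d : Fin 3 →₀ ℕ, coeff d P ≠ 0 → weight wt d ≤ β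

/-- A weight-homogeneous polynomial is weight-bounded by its weight. [folklore] -/
theorem WB.of_isWeightedHomogeneous (h : IsWeightedHomogeneous wt P β) : WB β P := fun _ hd => (h hd).le

/-- Weight bounds are monotone. [folklore] -/
theorem WB.mono (h : WB β P) (hβ : β ≤ γ) : WB γ P := fun d hd => (h d hd).trans hβ

/-- The zero polynomial has every weight bound. [folklore] -/
theorem WB.zero (β : ℤ) : WB β (0 : CPoly) := fun d hd => absurd (coeff_zero d) hd

/-- Weight bounds are stable under addition. [folklore] -/
theorem WB.add (hP : WB β P) (hQ : WB β Q) : WB β (P + Q) := by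
  intro d hd
  rw [coeff_add] at hd
  by_cases h : coeff d P = 0
  · rw [h, zero_add] at hd; exact hQ d hd
  · exact hP d h

/-- Weight bounds are stable under negation. [folklore] -/
theorem WB.neg (hP : WB β P) : WB β (-P) := fun d hd => hP d (by rwa [coeff_neg, neg_ne_zero] at hd)

/-- Weight bounds are stable under subtraction. [folklore] -/
theorem WB.sub (hP : WB β P) (hQ : WB β Q) : WB β (P - Q) := by
  rw [sub_eq_add_neg]; exact hP.add hQ.neg

/-- Weight bounds are stable under scalars. [folklore] -/
theorem WB.C_mul (hP : WB β P) (c : ℂ) : WB β (C c * P) := by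
  intro d hd
  rw [coeff_C_mul] at hd
  exact hP d (right_ne_zero_of_mul hd)

/-- Weight bounds add under multiplication. [folklore] -/
theorem WB.mul (hP : WB β P) (hQ : WB γ Q) : WB (β + γ) (P * Q) := by
  classical
  intro d hd
  have hmem : d ∈ (P * Q).support := MvPolynomial.mem_support_iff.mpr hd
  obtain ⟨d1, h1, d2, h2, rfl⟩ := Finset.mem_add.mp (support_mul P Q hmem)
  rw [map_add]
  exact add_le_add (hP d1 (MvPolynomial.mem_support_iff.mp h1)) (hQ d2 (MvPolynomial.mem_support_iff.mp h2))

/-- `∂_W` lowers a weight bound by one. [folklore] -/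
theorem WB.pderiv_zero (hP : WB β P) : WB (β - 1) (pderiv 0 P) := by
  intro d hd
  rw [coeff_pderiv] at hd
  have h := hP _ (left_ne_zero_of_mul hd)
  rw [map_add, weight_single, wt_zero] at h
  simp only [one_smul] at h
  linarith

/-- `∂_V` raises a weight bound by one. [folklore] -/
theorem WB.pderiv_one (hP : WB β P) : WB (β + 1) (pderiv 1 P) := by
  intro d hd
  rw [coeff_pderiv] at hd
  have h := hP _ (left_ne_zero_of_mul hd)
  rw [map_add, weight_single, wt_one] at h
  simp only [one_smul] at h
  linarith

/-- `∂_Z` preserves a weight bound. [folklore] -/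
theorem WB.pderiv_two (hP : WB β P) : WB β (pderiv 2 P) := by
  intro d hd
  rw [coeff_pderiv] at hd
  have h := hP _ (left_ne_zero_of_mul hd)
  rw [map_add, weight_single, wt_two] at h
  simpa using h

/-- `W` is bounded by weight `1`. [folklore] -/
theorem WB.X_zero : WB 1 (X 0 : CPoly) := WB.of_isWeightedHomogeneous isWeightedHomogeneous_X_zero
/-- `V` is bounded by weight `−1`. [folklore] -/
theorem WB.X_one : WB (-1) (X 1 : CPoly) := WB.of_isWeightedHomogeneous isWeightedHomogeneous_X_one
/-- `Z` is bounded by weight `0`. [folklore] -/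
theorem WB.X_two : WB 0 (X 2 : CPoly) := WB.of_isWeightedHomogeneous isWeightedHomogeneous_X_two

/-- `Λ` preserves weight bounds. [folklore] -/
theorem wb_lam (hP : WB β P) : WB β (lam P) := by
  unfold lam
  refine WB.sub ?_ ?_
  · simpa using WB.X_zero.mul hP.pderiv_zero
  · have h := WB.X_one.mul hP.pderiv_one
    convert h using 1; ring

/-- Weight bounds add under `dotC`. [folklore] -/
theorem wb_dotC (hP : WB β P) (hQ : WB γ Q) : WB (β + γ) (dotC P Q) := by
  unfold dotC
  refine WB.add (WB.C_mul (WB.add ?_ ?_) _) ?_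
  · convert hP.pderiv_zero.mul hQ.pderiv_one using 1; ring
  · convert hP.pderiv_one.mul hQ.pderiv_zero using 1; ring
  · exact hP.pderiv_two.mul hQ.pderiv_two

/-- Weight bounds add under `tripleC`. [folklore] -/
theorem wb_tripleC (hP : WB β P) (hQ : WB γ Q) : WB (β + γ) (tripleC P Q) := by
  unfold tripleC
  refine WB.add (WB.sub ?_ ?_) ?_
  · convert hQ.pderiv_two.mul (wb_lam hP) using 1; ring
  · exact hP.pderiv_two.mul (wb_lam hQ)
  · have h2 : WB 0 (C (2 : ℂ) * X 2 : CPoly) := WB.X_two.C_mul _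
    have h := h2.mul ((hP.pderiv_one.mul hQ.pderiv_zero).sub
      (by convert hP.pderiv_zero.mul hQ.pderiv_one using 1; ring))
    convert h using 1; ring

/-- Components above a weight bound vanish. [folklore] -/
theorem wcomp_eq_zero_of_WB (hP : WB β P) (hβ : β < γ) : weightedHomogeneousComponent wt γ P = 0 :=
  weightedHomogeneousComponent_eq_zero' γ P fun d hd h => by
    have := hP d (MvPolynomial.mem_support_iff.mp hd); rw [h] at this; exact absurd this (not_le.mpr hβ)

/-- Weight components of a homogeneous polynomial are homogeneous of the same degree. [folklore] -/
theorem isHomogeneous_wcomp (hQ : Q.IsHomogeneous l) (m : ℤ) : (weightedHomogeneousComponent wt m Q).IsHomogeneous l := by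
  classical
  intro d hd
  rw [coeff_weightedHomogeneousComponent] at hd
  split_ifs at hd with h
  · exact hQ hd
  · exact absurd rfl hd

/-- `Δ̃` commutes with taking weight components (it preserves the weight monomial by monomial). -/
theorem wcomp_lapC (m : ℤ) (Q : CPoly) : weightedHomogeneousComponent wt m (lapC Q) = lapC (weightedHomogeneousComponent wt m Q) := by
  classical
  ext d
  simp only [lapC, coeff_weightedHomogeneousComponent, coeff_add, coeff_C_mul, coeff_pderiv_pderiv]
  have w1 : weight wt (d + single 0 1 + single 1 1) = weight wt d := by
    rw [map_add, map_add, weight_wt (single 0 1), weight_wt (single 1 1)]; simp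
  have w2 : weight wt (d + single 2 1 + single 2 1) = weight wt d := by
    rw [map_add, map_add, weight_wt (single 2 1)]; simp
  rw [w1, w2]
  split_ifs <;> ring

/-- The sub-top remainder: `Q − Q_β` has all weights `≤ β − 1` when `Q` has all weights `≤ β`. -/
theorem WB.sub_wcomp (hQ : WB β Q) : WB (β - 1) (Q - weightedHomogeneousComponent wt β Q) := by
  classical
  intro d hd
  rw [coeff_sub, coeff_weightedHomogeneousComponent] at hd
  split_ifs at hd with h
  · simp at hd
  · rw [sub_zero] at hd
    have := hQ d hd
    omega

/-- **Top component of the cubic form**: if all weights of `Q` are `≤ β`, the weight-`3β` component of `D̃(Q)` is `D̃(Q_β)`. -/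
theorem wcomp_detC_top (hQ : WB β Q) : weightedHomogeneousComponent wt (3 * β) (detC Q) = detC (weightedHomogeneousComponent wt β Q) := by
  set A := weightedHomogeneousComponent wt β Q with hA
  set R := Q - A with hR
  have hAw : IsWeightedHomogeneous wt A β := weightedHomogeneousComponent_isWeightedHomogeneous β Q
  have hAb : WB β A := WB.of_isWeightedHomogeneous hAw
  have hRb : WB (β - 1) R := hQ.sub_wcomp
  have hQAR : Q = A + R := by rw [hR]; ring
  -- expand `detC (A + R)` by (bi)linearity
  have hdot : dotC (A + R) (A + R) = dotC A A + (dotC A R + dotC R A + dotC R R) := by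
    unfold dotC; simp only [map_add]; ring
  have htri : ∀ X Y Z : CPoly, tripleC X (Y + Z) = tripleC X Y + tripleC X Z := by
    intro X Y Z; unfold tripleC lam; simp only [map_add]; ring
  have htri' : ∀ X Y Z : CPoly, tripleC (X + Y) Z = tripleC X Z + tripleC Y Z := by
    intro X Y Z; unfold tripleC lam; simp only [map_add]; ring
  have hexp : detC Q = detC A + (tripleC A (dotC A R + dotC R A + dotC R R)
      + tripleC R (dotC A A) + tripleC R (dotC A R + dotC R A + dotC R R)) := by
    rw [hQAR, detC, hdot, htri' A R, htri A (dotC A A), htri R (dotC A A), detC]; ring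
  -- the three error terms have weights `< 3β`
  have hE1 : WB (2 * β - 1) (dotC A R + dotC R A + dotC R R) := by
    refine ((WB.add ?_ ?_).add ?_)
    · convert wb_dotC hAb hRb using 1; ring
    · convert wb_dotC hRb hAb using 1; ring
    · exact (wb_dotC hRb hRb).mono (by omega)
  have hT1 : WB (3 * β - 1) (tripleC A (dotC A R + dotC R A + dotC R R)) := by
    convert wb_tripleC hAb hE1 using 1; ring
  have hT2 : WB (3 * β - 1) (tripleC R (dotC A A)) := by
    convert wb_tripleC hRb (wb_dotC hAb hAb) using 1; ring
  have hT3 : WB (3 * β - 1) (tripleC R (dotC A R + dotC R A + dotC R R)) :=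
    (wb_tripleC hRb hE1).mono (by omega)
  rw [hexp, map_add, map_add, map_add, wcomp_eq_zero_of_WB hT1 (by omega), wcomp_eq_zero_of_WB hT2 (by omega),
    wcomp_eq_zero_of_WB hT3 (by omega), add_zero, add_zero, add_zero]
  exact (isWeightedHomogeneous_detC hAw).weightedHomogeneousComponent_same

/-! #### The `W ↔ V` mirror -/

/-- The mirror `W ↔ V` (complex conjugation of the coordinates, as a change of variables). -/
abbrev mirror : CPoly →ₐ[ℂ] CPoly := rename (Equiv.swap (0 : Fin 3) 1)

/-- Mirror rule: `∂_W ∘ σ = σ ∘ ∂_V`. [folklore] -/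
theorem mirror_pderiv_zero (P : CPoly) : pderiv 0 (mirror P) = mirror (pderiv 1 P) := by
  have h := pderiv_rename (Equiv.swap (0 : Fin 3) 1).injective 1 P
  rwa [show (Equiv.swap (0 : Fin 3) 1) 1 = 0 by decide] at h

/-- Mirror rule: `∂_V ∘ σ = σ ∘ ∂_W`. [folklore] -/
theorem mirror_pderiv_one (P : CPoly) : pderiv 1 (mirror P) = mirror (pderiv 0 P) := by
  have h := pderiv_rename (Equiv.swap (0 : Fin 3) 1).injective 0 P
  rwa [show (Equiv.swap (0 : Fin 3) 1) 0 = 1 by decide] at h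

/-- Mirror rule: `∂_Z ∘ σ = σ ∘ ∂_Z`. [folklore] -/
theorem mirror_pderiv_two (P : CPoly) : pderiv 2 (mirror P) = mirror (pderiv 2 P) := by
  have h := pderiv_rename (Equiv.swap (0 : Fin 3) 1).injective 2 P
  rwa [show (Equiv.swap (0 : Fin 3) 1) 2 = 2 by decide] at h

/-- `Δ̃` is mirror-even. [folklore] -/
theorem mirror_lapC (P : CPoly) : lapC (mirror P) = mirror (lapC P) := by
  unfold lapC
  rw [mirror_pderiv_one, mirror_pderiv_zero, mirror_pderiv_two, mirror_pderiv_two, pderiv_comm 1 0 P]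
  simp [map_add, map_mul]

/-- `dotC` is mirror-even. [folklore] -/
theorem mirror_dotC (A B : CPoly) : dotC (mirror A) (mirror B) = mirror (dotC A B) := by
  unfold dotC
  rw [mirror_pderiv_zero, mirror_pderiv_one, mirror_pderiv_two, mirror_pderiv_zero, mirror_pderiv_one,
    mirror_pderiv_two]
  simp only [map_add, map_mul, rename_C]
  ring

/-- `Λ` is mirror-odd. [folklore] -/
theorem mirror_lam (A : CPoly) : lam (mirror A) = -mirror (lam A) := by
  unfold lam
  rw [mirror_pderiv_zero, mirror_pderiv_one]
  simp only [map_sub, map_mul, rename_X]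
  rw [show (Equiv.swap (0 : Fin 3) 1) 0 = 1 by decide, show (Equiv.swap (0 : Fin 3) 1) 1 = 0 by decide]
  ring

/-- `tripleC` is mirror-odd. [folklore] -/
theorem mirror_tripleC (A B : CPoly) : tripleC (mirror A) (mirror B) = -mirror (tripleC A B) := by
  unfold tripleC
  rw [mirror_lam, mirror_lam, mirror_pderiv_two, mirror_pderiv_two, mirror_pderiv_zero, mirror_pderiv_one,
    mirror_pderiv_zero, mirror_pderiv_one]
  simp only [map_add, map_sub, map_mul, rename_C, rename_X]
  rw [show (Equiv.swap (0 : Fin 3) 1) 2 = 2 by decide]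
  ring

/-- `D̃` is mirror-odd. [folklore] -/
theorem mirror_detC (Q : CPoly) : detC (mirror Q) = -mirror (detC Q) := by
  rw [detC, mirror_dotC, mirror_tripleC, detC]

/-- The mirror negates azimuthal weights. [folklore] -/
theorem weight_mapDomain_swap (d : Fin 3 →₀ ℕ) :
    weight wt (d.mapDomain (Equiv.swap (0 : Fin 3) 1)) = -weight wt d := by
  have h0 : (d.mapDomain (Equiv.swap (0 : Fin 3) 1)) 0 = d 1 := by
    have h := Finsupp.mapDomain_apply (Equiv.swap (0 : Fin 3) 1).injective d 1
    rwa [Equiv.swap_apply_right] at h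
  have h1 : (d.mapDomain (Equiv.swap (0 : Fin 3) 1)) 1 = d 0 := by
    have h := Finsupp.mapDomain_apply (Equiv.swap (0 : Fin 3) 1).injective d 0
    rwa [Equiv.swap_apply_left] at h
  rw [weight_wt, weight_wt, h0, h1]; ring

/-- Coefficients of the mirror image. [folklore] -/
theorem coeff_mirror (d : Fin 3 →₀ ℕ) (Q : CPoly) :
    coeff (d.mapDomain (Equiv.swap (0 : Fin 3) 1)) (mirror Q) = coeff d Q :=
  coeff_rename_mapDomain _ (Equiv.swap (0 : Fin 3) 1).injective Q d

/-! #### The top-weight theorem -/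

/-- **No positive weights** (memo Corollary D + Lemma E's hypothesis): a degree-`l` (`l ≥ 1`) polynomial with `Δ̃Q = 0`, `D̃(Q) = 0` and no
`W^l` term has all its azimuthal weights `≤ 0`. -/
theorem weight_nonpos_of_detC (hQ : Q.IsHomogeneous l) (hlap : lapC Q = 0) (hdet : detC Q = 0)
    (hW : coeff (single 0 l) Q = 0) : ∀ d : Fin 3 →₀ ℕ, coeff d Q ≠ 0 → weight wt d ≤ 0 := by
  classical
  by_contra hcon
  push Not at hcon
  obtain ⟨d₀, hd₀, hpos⟩ := hcon
  -- the top weight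
  set S : Finset ℤ := Q.support.image (weight wt) with hS
  have hSne : S.Nonempty := ⟨weight wt d₀, Finset.mem_image_of_mem _ (MvPolynomial.mem_support_iff.mpr hd₀)⟩
  set Mz : ℤ := S.max' hSne with hMz
  have hWB : WB Mz Q := fun d hd => Finset.le_max' S _ (Finset.mem_image_of_mem _ (MvPolynomial.mem_support_iff.mpr hd))
  have hMpos : 0 < Mz := lt_of_lt_of_le hpos (hWB d₀ hd₀)
  obtain ⟨d₁, hd₁S, hd₁w⟩ : ∃ d₁ ∈ Q.support, weight wt d₁ = Mz := by
    have := Finset.max'_mem S hSne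
    rw [← hMz] at this
    simpa [hS] using this
  have hc₁ : coeff d₁ Q ≠ 0 := MvPolynomial.mem_support_iff.mp hd₁S
  obtain ⟨hw₁, hdeg₁⟩ := exponent_of_mem_support
    (weightedHomogeneousComponent_isWeightedHomogeneous Mz Q) (isHomogeneous_wcomp hQ Mz)
    (d := d₁) (MvPolynomial.mem_support_iff.mpr (by
      rw [coeff_weightedHomogeneousComponent, if_pos hd₁w]; exact hc₁))
  -- `Mz ≤ l`, and `Mz = l` would force `d₁ = W^l`
  have hMl : Mz < l := by
    rcases lt_or_ge Mz l with h | h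
    · exact h
    · exfalso
      have h0 : d₁ 0 = l := by omega
      have h1 : d₁ 1 = 0 := by omega
      have h2 : d₁ 2 = 0 := by omega
      have : d₁ = single 0 l := by
        rw [eq_tri d₁, h0, h1, h2]; ext i; fin_cases i <;> simp
      rw [this] at hc₁
      exact hc₁ hW
  -- the top slot
  set M : ℕ := Mz.toNat with hM
  have hMz' : (M : ℤ) = Mz := Int.toNat_of_nonneg hMpos.le
  obtain ⟨dd, hdd⟩ : ∃ dd, l = M + dd := ⟨l - M, by omega⟩
  have hA : IsWeightedHomogeneous wt (weightedHomogeneousComponent wt Mz Q) (M : ℤ) := by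
    rw [hMz']; exact weightedHomogeneousComponent_isWeightedHomogeneous Mz Q
  have hAh : (weightedHomogeneousComponent wt Mz Q).IsHomogeneous (M + dd) := hdd ▸ isHomogeneous_wcomp hQ Mz
  have hAlap : lapC (weightedHomogeneousComponent wt Mz Q) = 0 := by rw [← wcomp_lapC, hlap, map_zero]
  have hAdet : detC (weightedHomogeneousComponent wt Mz Q) = 0 := by rw [← wcomp_detC_top hWB, hdet, map_zero]
  have hA0 := slot_eq_zero hA hAh (by omega) (by omega) hAlap hAdet
  have : coeff d₁ (weightedHomogeneousComponent wt Mz Q) = 0 := by rw [hA0, coeff_zero]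
  rw [coeff_weightedHomogeneousComponent, if_pos hd₁w] at this
  exact hc₁ this

/-- ★ **Top-weight theorem** (memo §4 in the complex-coordinate model): a degree-`l` (`l ≥ 1`) polynomial `Q` in `(W, V, Z)` with
`Δ̃Q = 0`, `D̃(Q) = 0` and neither a `W^l` nor a `V^l` term is purely of weight `0` — i.e. `ΛQ = 0`: it is invariant under the
rotations about the axis. -/
theorem isWeightedHomogeneous_zero_of_detC (hQ : Q.IsHomogeneous l) (hlap : lapC Q = 0) (hdet : detC Q = 0)
    (hW : coeff (single 0 l) Q = 0) (hV : coeff (single 1 l) Q = 0) : IsWeightedHomogeneous wt Q 0 := by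
  classical
  intro d hd
  have h1 := weight_nonpos_of_detC hQ hlap hdet hW d hd
  -- the mirror image has no positive weights either
  have hQ' : (mirror Q).IsHomogeneous l := hQ.rename_isHomogeneous
  have hlap' : lapC (mirror Q) = 0 := by rw [mirror_lapC, hlap, map_zero]
  have hdet' : detC (mirror Q) = 0 := by rw [mirror_detC, hdet, map_zero, neg_zero]
  have hW' : coeff (single 0 l) (mirror Q) = 0 := by
    have := coeff_mirror (single 1 l) Q
    rwa [Finsupp.mapDomain_single, show (Equiv.swap (0 : Fin 3) 1) 1 = 0 by decide, hV] at this
  have h2 := weight_nonpos_of_detC hQ' hlap' hdet' hW' (d.mapDomain (Equiv.swap (0 : Fin 3) 1))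
    (by rw [coeff_mirror]; exact hd)
  rw [weight_mapDomain_swap] at h2
  exact le_antisymm h1 (by omega)

/-- `Λ` acts on a weight-`m` polynomial as the scalar `m`. -/
theorem lam_eq_smul_of_isWeightedHomogeneous {m : ℤ} (h : IsWeightedHomogeneous wt Q m) : lam Q = (m : ℂ) • Q := by
  classical
  ext d
  have key : ∀ i : Fin 3, coeff d (X i * pderiv i Q) = (d i : ℂ) * coeff d Q := by
    intro i
    rw [coeff_X_mul']
    split_ifs with hi
    · rw [coeff_pderiv]
      have hdi : 1 ≤ d i := Nat.one_le_iff_ne_zero.mpr (Finsupp.mem_support_iff.mp hi)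
      have : d - single i 1 + single i 1 = d := by
        ext j
        simp only [Finsupp.coe_add, Finsupp.coe_tsub, Pi.add_apply, Pi.sub_apply, single_apply]
        split_ifs with hij
        · subst hij; omega
        · omega
      rw [this]
      have : (((d - single i 1 : Fin 3 →₀ ℕ) i : ℕ) : ℂ) + 1 = d i := by
        rw [Finsupp.tsub_apply, single_eq_same, Nat.cast_sub hdi]; push_cast; ring
      rw [this]; ring
    · have : d i = 0 := by simpa using hi
      rw [this]; simp
  rw [lam, coeff_sub, key 0, key 1, coeff_smul, smul_eq_mul]
  by_cases hq : coeff d Q = 0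
  · rw [hq]; ring
  · have hw := h hq
    rw [weight_wt] at hw
    rw [← hw]; push_cast; ring

/-- Corollary: under the hypotheses of the top-weight theorem, `ΛQ = 0`. -/
theorem lam_eq_zero_of_detC (hQ : Q.IsHomogeneous l) (hlap : lapC Q = 0) (hdet : detC Q = 0)
    (hW : coeff (single 0 l) Q = 0) (hV : coeff (single 1 l) Q = 0) : lam Q = 0 := by
  rw [lam_eq_smul_of_isWeightedHomogeneous (isWeightedHomogeneous_zero_of_detC hQ hlap hdet hW hV)]
  simp

end Descent

end Summit.NavierStokesRegularity.NavierStokesRegularity.Theorems.PoloidalLiouville.HorizonTower.Zonal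

end
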